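import Mathlib
import Literature.Computability.AlgebraicComplexity.ArithCircuitProofs
import Literature.Computability.AlgebraicComplexity.IMMInVPProofs
import Summits.ValiantsHypothesis.ValiantsHypothesis.Theses.DivisionGap
import Summits.ValiantsHypothesis.ValiantsHypothesis.Theorems.DivisionGapSensitiveStDivisionEasyDet

/-!
# `SensitiveStDivisionEasy` (route DivisionGap, item `stmt-ValiantsHypothesis-10464`)

CDGM's `ε`-sensitive monotone-hard `VP` witness `F_{n-1,n} ∓ ε·ST_n = Σ_t c_t ∏_i x_{(i,t i)}`
(`c_t = 1 ∓ ε` on arborescences, `1` otherwise) has POLYNOMIAL DIVISION COMPLEXITY over `ℝ≥0`: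
there is a nonzero `h` with `L₊((F ∓ εST)·h) + L₊(h) ≤ N^60 + 60`, `L₊` = the tree's fan-in-two
`complexity` over the semiring `ℝ≥0` (monotone circuits; constants of `ℝ≥0` are free).

Proof. Run the fraction-free star–mesh elimination of
`DivisionGapSensitiveStDivisionEasyElim.lean` and take `h := pr_N = ∏_κ R_κ`, the product of the
full row masses met along the way. Over `ℝ` (and pulled back to `ℝ≥0` by injectivity of
`map NNReal.toRealHom`):
`(F + (a-1)·ST) · pr_N = F·pr_N + (a-1)·F·ps_N = F·(a·ps_N + u_N)` by `ST·pr_N = F·ps_N`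
(`stPoly_mul_pr`, determinant bookkeeping) and `pr_N = ps_N + u_N` (telescoping), where for the
item `a = 1 ∓ ε ≥ 0`; both `pr_N` and `F·(a·ps_N + u_N)` are images of `O(1)`-size expressions
under `N` successive substitutions of cost `(N(N+1)+3)(N+4)` each (`complexity_aeval_le`, the
sharing device of `IMMInVPProofs.lean`), whence the bound (`complexity_witness_le`); `pr_N ≠ 0`
because it is positive at the all-ones point (`pr_ne_zero`).
-/

noncomputable section

-- `Summit.<Summit>.<Problem>` repeats `ValiantsHypothesis` by the tree's layout convention (D-0017).
set_option linter.dupNamespace false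

namespace Summit.ValiantsHypothesis.ValiantsHypothesis.Theorems

namespace SensitiveStElim

open MvPolynomial Finset Literature.Computability.AlgebraicComplexity
  Literature.Barriers.ValiantsHypothesis

open scoped NNReal

universe u

variable (R : Type u) [CommSemiring R] (N : ℕ)

/-! ### Cost: every level-`k` value has fan-in-two complexity `≤ k · Cstep N` -/

section Cost

variable {N}

/-- `L(0) = 0`. -/
theorem complexity_zero_eq {τ : Type*} : complexity (0 : MvPolynomial τ R) = 0 := by
  rw [← C_0]; exact complexity_C_holds _

/-- `L(1) = 0`. -/
theorem complexity_one_eq {τ : Type*} : complexity (1 : MvPolynomial τ R) = 0 := by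
  rw [← C_1]; exact complexity_C_holds _

/-- `L(sVar κ) ≤ N` (a sum of `N` variables). -/
theorem complexity_sVar_le (κ : Fin N) : complexity (sVar R N κ) ≤ N := by
  refine (complexity_finset_sum_le _ _).trans ?_
  rw [Finset.sum_eq_zero (fun v _ => complexity_X_holds _), zero_add,
    Finset.card_erase_of_mem (mem_univ _), Finset.card_univ, Fintype.card_option, Fintype.card_fin]
  simp

/-- `L(rVar κ) ≤ N + 1` (a sum of `N + 1` variables). -/
theorem complexity_rVar_le (κ : Fin N) : complexity (rVar R N κ) ≤ N + 1 := by
  refine (complexity_finset_sum_le _ _).trans ?_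
  rw [Finset.sum_eq_zero (fun v _ => complexity_X_holds _), zero_add,
    Finset.card_univ, Fintype.card_option, Fintype.card_fin]

/-- Every substituted polynomial of one step costs at most `N + 4` gates. -/
theorem complexity_stepV_le (κ : Fin N) (w : St N) : complexity (stepV R N κ w) ≤ N + 4 := by
  have hX : ∀ w : St N, complexity (X w : MvPolynomial (St N) R) = 0 := complexity_X_holds
  have hS := complexity_sVar_le R κ
  have hR := complexity_rVar_le R κ
  rcases w with ⟨i, v⟩ | j
  · simp only [stepV]
    split_ifs
    · rw [complexity_zero_eq]; exact Nat.zero_le _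
    · refine (complexity_add_le_holds _ _).trans ?_
      have h1 := complexity_mul_le_holds (sVar R N κ) (X (Sum.inl (i, v)))
      have h2 := complexity_mul_le_holds (X (Sum.inl (i, some κ)) : MvPolynomial (St N) R)
        (X (Sum.inl (κ, v)))
      rw [hX, hX] at h2; rw [hX] at h1
      omega
  · fin_cases j
    · simp only [stepV, Fin.zero_eta, Matrix.cons_val_zero]
      have h1 := complexity_mul_le_holds (X (Sum.inr 0) : MvPolynomial (St N) R) (sVar R N κ)
      rw [hX] at h1; omega
    · simp only [stepV, Fin.mk_one, Matrix.cons_val_one, Matrix.cons_val_zero]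
      have h1 := complexity_mul_le_holds (X (Sum.inr 1) : MvPolynomial (St N) R) (rVar R N κ)
      rw [hX] at h1; omega
    · simp only [stepV, Fin.reduceFinMk, Matrix.cons_val_two, Matrix.tail_cons, Matrix.head_cons]
      refine (complexity_add_le_holds _ _).trans ?_
      have h1 := complexity_mul_le_holds (X (Sum.inr 2) : MvPolynomial (St N) R) (rVar R N κ)
      have h2 := complexity_mul_le_holds (X (Sum.inl (κ, some κ)) : MvPolynomial (St N) R)
        (X (Sum.inr 0))
      rw [hX] at h1; rw [hX, hX] at h2
      omega

/-- The same for `step k`. -/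
theorem complexity_step_le (k : ℕ) (w : St N) : complexity (step R N k w) ≤ N + 4 := by
  unfold step
  split_ifs
  · exact complexity_stepV_le R _ w
  · rw [complexity_X_holds]; exact Nat.zero_le _

/-- One level of substitutions costs at most `Cstep N = (N(N+1)+3)(N+4)`. -/
theorem sum_complexity_step_le (k : ℕ) : ∑ w, complexity (step R N k w) ≤ Cstep N := by
  refine (Finset.sum_le_card_nsmul _ _ (N + 4) (fun w _ => complexity_step_le R k w)).trans ?_
  rw [Finset.card_univ, card_St, smul_eq_mul, Cstep]

/-- The backward substitution costs `Cstep N` per level (substitution bound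
`complexity_aeval_le`). -/
theorem complexity_lower_le (k : ℕ) (φ : MvPolynomial (St N) R) :
    complexity (lower R N k φ) ≤ complexity φ + k * Cstep N := by
  induction k generalizing φ with
  | zero => simp [lower]
  | succ k ih =>
    simp only [lower]
    refine (ih _).trans ?_
    have h := complexity_aeval_le φ (step R N k)
    have h' := sum_complexity_step_le R (N := N) k
    rw [Nat.succ_mul]
    omega

/-- The initial values are variables and constants: free. -/
theorem sum_complexity_init : ∑ w, complexity (init R N w) = 0 := by
  refine Finset.sum_eq_zero fun w _ => ?_
  rcases w with e | j
  · exact complexity_X_holds e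
  · fin_cases j
    · exact complexity_one_eq R
    · exact complexity_one_eq R
    · exact complexity_zero_eq R

/-- Hence substituting the initial values is free. -/
theorem complexity_aeval_init_le (φ : MvPolynomial (St N) R) :
    complexity (aeval (init R N) φ) ≤ complexity φ := by
  have h := complexity_aeval_le φ (init R N)
  rwa [sum_complexity_init, add_zero] at h

/-- **Polynomial size of the elimination**: every state polynomial after `k` eliminations has
fan-in-two circuit complexity at most `k · (N(N+1)+3)(N+4)`. -/
theorem complexity_val_le (k : ℕ) (w : St N) : complexity (val R N k w) ≤ k * Cstep N := by
  rw [val_eq_aeval_lower]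
  refine (complexity_aeval_init_le R _).trans ?_
  have h := complexity_lower_le R k (X w : MvPolynomial (St N) R)
  rwa [complexity_X_holds, zero_add] at h

/-- The same for a level-`k` expression `c · ps + u`. -/
theorem complexity_C_mul_ps_add_u_le (k : ℕ) (c : R) :
    complexity (C c * val R N k (Sum.inr 0) + val R N k (Sum.inr 2)) ≤ 2 + k * Cstep N := by
  have hφ : complexity (C c * X (Sum.inr 0) + X (Sum.inr 2) : MvPolynomial (St N) R) ≤ 2 := by
    refine (complexity_add_le_holds _ _).trans ?_
    have h1 := complexity_mul_le_holds (C c : MvPolynomial (St N) R) (X (Sum.inr 0))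
    rw [complexity_C_holds, complexity_X_holds] at h1
    rw [complexity_X_holds]
    omega
  have he : C c * val R N k (Sum.inr 0) + val R N k (Sum.inr 2) =
      aeval (init R N) (lower R N k (C c * X (Sum.inr 0) + X (Sum.inr 2))) := by
    rw [aeval_init_lower, map_add, map_mul, aeval_X, aeval_X, aeval_C, algebraMap_eq]
  rw [he]
  refine (complexity_aeval_init_le R _).trans ?_
  exact (complexity_lower_le R k _).trans (by omega)

variable (N)

/-- `L(F) ≤ N(N+1) + N`. -/
theorem complexity_fPoly_le : complexity (fPoly R N) ≤ N * (N + 1) + N := by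
  refine (complexity_finset_prod_le _ _).trans ?_
  have h : ∀ i ∈ (univ : Finset (Fin N)), complexity (rowX R N i) ≤ N + 1 := fun i _ => by
    refine (complexity_finset_sum_le _ _).trans ?_
    rw [Finset.sum_eq_zero (fun v _ => complexity_X_holds _), zero_add,
      Finset.card_univ, Fintype.card_option, Fintype.card_fin]
  refine Nat.add_le_add ((Finset.sum_le_sum h).trans ?_) (by simp)
  simp

end Cost

/-! ### `pr_N ≠ 0`: positivity at the all-ones point -/

section Pos

/-- Every weight of an edge into the root stays positive at the all-ones point. -/
theorem eval_one_val_none_pos (k : ℕ) (i : Fin N) :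
    0 < eval (fun _ => (1 : ℝ≥0)) (val ℝ≥0 N k (Sum.inl (i, none))) := by
  induction k generalizing i with
  | zero => simp
  | succ k ih =>
    rcases Nat.lt_or_ge k N with hk | hk
    · have h := val_succ_inl (R := ℝ≥0) ⟨k, hk⟩ i none
      rw [if_neg (Option.some_ne_none _).symm] at h
      rw [h, map_add, map_mul]
      refine add_pos_of_pos_of_nonneg (mul_pos ?_ (ih i)) bot_le
      rw [S, map_sum]
      refine lt_of_lt_of_le (ih ⟨k, hk⟩) ?_
      exact Finset.single_le_sum (f := fun v => eval (fun _ => (1 : ℝ≥0))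
        (val ℝ≥0 N k (Sum.inl (⟨k, hk⟩, v)))) (fun _ _ => bot_le) (by simp)
    · rw [val_succ_of_le hk]
      exact ih i

/-- Hence `pr_k` is positive at the all-ones point. -/
theorem eval_one_pr_pos (k : ℕ) :
    0 < eval (fun _ => (1 : ℝ≥0)) (val ℝ≥0 N k (Sum.inr 1)) := by
  induction k with
  | zero => simp
  | succ k ih =>
    rcases Nat.lt_or_ge k N with hk | hk
    · have h := val_succ_pr (R := ℝ≥0) ⟨k, hk⟩
      rw [h, map_mul]
      refine mul_pos ih ?_
      rw [Rt, map_sum]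
      refine lt_of_lt_of_le (eval_one_val_none_pos N k ⟨k, hk⟩) ?_
      exact Finset.single_le_sum (f := fun v => eval (fun _ => (1 : ℝ≥0))
        (val ℝ≥0 N k (Sum.inl (⟨k, hk⟩, v)))) (fun _ _ => bot_le) (by simp)
    · rw [val_succ_of_le hk]
      exact ih

/-- The divisor `h = pr_N` is a nonzero polynomial. -/
theorem pr_ne_zero : val ℝ≥0 N N (Sum.inr 1) ≠ 0 := fun h => by
  have := eval_one_pr_pos N N
  rw [h, map_zero] at this
  exact lt_irrefl _ this

end Pos

/-! ### The identity `(F + (a-1)·ST) · pr_N = F · (a·ps_N + u_N)` -/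

section Identity

/-- Over a commutative ring: `(F + (a-1)·ST) · pr_N = F · (a·ps_N + u_N)`. -/
theorem fPoly_add_mul_pr {A : Type u} [CommRing A] (a : A) :
    (fPoly A N + C (a - 1) * stPoly A N) * val A N N (Sum.inr 1) =
      fPoly A N * (C a * val A N N (Sum.inr 0) + val A N N (Sum.inr 2)) := by
  have h1 := stPoly_mul_pr (R := A) (N := N)
  have h2 := pr_eq_ps_add_u (R := A) (N := N) N
  rw [add_mul, mul_assoc, h1, h2, map_sub, C_1]
  ring

open Classical in
/-- The sensitive witness maps to `F + (a-1)·ST` over `ℝ`: for any predicate `p` that singles out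
the arborescences and any nonnegative top coefficient `a`,
`map (Σ_t (if p t then a else 1) • ∏_i x_{(i,t i)}) = F + (a-1)·ST`. (The decidability instance
is an implicit argument so that the lemma applies to the route's classical `if`.) -/
theorem map_witness {p : (Fin N → Option (Fin N)) → Prop} {inst : DecidablePred p}
    (hp : ∀ t, p t ↔ IsArborescence t) (a : ℝ≥0) :
    map NNReal.toRealHom (∑ t : Fin N → Option (Fin N),
        (if p t then a else (1 : ℝ≥0)) •
          ∏ i : Fin N, (X (i, t i) : MvPolynomial (Edge N) ℝ≥0)) =
      fPoly ℝ N + C ((a : ℝ) - 1) * stPoly ℝ N := by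
  rw [_root_.map_sum]
  have hterm : ∀ t : Fin N → Option (Fin N),
      map NNReal.toRealHom ((if p t then a else (1 : ℝ≥0)) •
        ∏ i : Fin N, (X (i, t i) : MvPolynomial (Edge N) ℝ≥0)) =
      (∏ i : Fin N, (X (i, t i) : MvPolynomial (Edge N) ℝ)) +
        (if p t then C ((a : ℝ) - 1) * ∏ i : Fin N, (X (i, t i) : MvPolynomial (Edge N) ℝ)
          else 0) := by
    intro t
    rw [smul_eq_C_mul, _root_.map_mul, map_C, _root_.map_prod]
    simp only [map_X]
    split_ifs
    · rw [map_sub, C_1]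
      simp
      ring
    · simp
  simp_rw [hterm]
  rw [Finset.sum_add_distrib, ← fPoly_eq_sum, ← Finset.sum_filter, ← Finset.mul_sum,
    Finset.filter_congr (fun t _ => hp t), stPoly]

/-- Pulled back to `ℝ≥0`: the witness times `pr_N` is `F · (a·ps_N + u_N)`. -/
theorem witness_mul_pr {p : (Fin N → Option (Fin N)) → Prop} {inst : DecidablePred p}
    (hp : ∀ t, p t ↔ IsArborescence t) (a : ℝ≥0) :
    (∑ t : Fin N → Option (Fin N),
        (if p t then a else (1 : ℝ≥0)) •
          ∏ i : Fin N, (X (i, t i) : MvPolynomial (Edge N) ℝ≥0)) *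
        val ℝ≥0 N N (Sum.inr 1) =
      fPoly ℝ≥0 N * (C a * val ℝ≥0 N N (Sum.inr 0) + val ℝ≥0 N N (Sum.inr 2)) := by
  apply MvPolynomial.map_injective (NNReal.toRealHom) NNReal.coe_injective
  rw [_root_.map_mul, map_witness N hp a, map_val, fPoly_add_mul_pr, _root_.map_mul, map_fPoly,
    _root_.map_add, _root_.map_mul, map_C, map_val, map_val]
  rfl

end Identity

/-! ### The count -/

section Count

/-- The numerical bound `2N·Cstep N + N(N+1) + N + 3 ≤ N^60 + 60`. -/
theorem cost_poly_le : 2 * (N * Cstep N) + (N * (N + 1) + N) + 3 ≤ N ^ 60 + 60 := by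
  unfold Cstep
  rcases Nat.lt_or_ge N 2 with h | h
  · interval_cases N <;> norm_num
  · have h1 : N ≤ N ^ 4 := by
      calc N = N ^ 1 := (pow_one N).symm
        _ ≤ N ^ 4 := Nat.pow_le_pow_right (by omega) (by norm_num)
    have h2 : N ^ 2 ≤ N ^ 4 := Nat.pow_le_pow_right (by omega) (by norm_num)
    have h3 : N ^ 3 ≤ N ^ 4 := Nat.pow_le_pow_right (by omega) (by norm_num)
    have h0 : 1 ≤ N ^ 4 := Nat.one_le_pow _ _ (by omega)
    have h4 : 2 * (N * ((N * (N + 1) + 3) * (N + 4))) + (N * (N + 1) + N) + 3 ≤ 56 * N ^ 4 := by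
      nlinarith [h1, h2, h3, h0]
    have h6 : 56 ≤ N ^ 6 :=
      le_trans (by norm_num) (Nat.pow_le_pow_left h 6)
    calc 2 * (N * ((N * (N + 1) + 3) * (N + 4))) + (N * (N + 1) + N) + 3
        ≤ 56 * N ^ 4 := h4
      _ ≤ N ^ 6 * N ^ 4 := Nat.mul_le_mul_right _ h6
      _ = N ^ 10 := by ring
      _ ≤ N ^ 60 := Nat.pow_le_pow_right (by omega) (by norm_num)
      _ ≤ N ^ 60 + 60 := Nat.le_add_right _ _

/-- The division-complexity bound for the witness, for any arborescence predicate and any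
nonnegative top coefficient: `L₊(witness · pr_N) + L₊(pr_N) ≤ N^60 + 60`. -/
theorem complexity_witness_le {p : (Fin N → Option (Fin N)) → Prop} {inst : DecidablePred p}
    (hp : ∀ t, p t ↔ IsArborescence t) (a : ℝ≥0) :
    complexity ((∑ t : Fin N → Option (Fin N),
        (if p t then a else (1 : ℝ≥0)) •
          ∏ i : Fin N, (X (i, t i) : MvPolynomial (Edge N) ℝ≥0)) *
        val ℝ≥0 N N (Sum.inr 1)) +
      complexity (val ℝ≥0 N N (Sum.inr 1)) ≤ N ^ 60 + 60 := by
  rw [witness_mul_pr N hp a]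
  have hA := complexity_mul_le_holds (fPoly ℝ≥0 N)
    (C a * val ℝ≥0 N N (Sum.inr 0) + val ℝ≥0 N N (Sum.inr 2))
  have hF := complexity_fPoly_le ℝ≥0 N
  have hB := complexity_C_mul_ps_add_u_le ℝ≥0 (N := N) N a
  have hh := complexity_val_le ℝ≥0 (N := N) N (Sum.inr 1)
  have hc := cost_poly_le N
  omega

end Count

end SensitiveStElim

open SensitiveStElim in
/-- **Item `stmt-ValiantsHypothesis-10464` (`SensitiveStDivisionEasy`).** CDGM's `ε`-sensitive
witness `F_{n-1,n} ∓ ε·ST_n` over `ℝ≥0` has polynomial division complexity: with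
`h = pr_N` (the product of the row masses along the star–mesh elimination), `h ≠ 0` and
`L₊((F ∓ εST)·h) + L₊(h) ≤ N^60 + 60` for every `N`, every `ε < 1` and both signs. (The
hypothesis `ε < 1` is not used: for `ε ≥ 1` the truncated coefficient `1 - ε = 0` of `ℝ≥0` is
covered as well.) -/
theorem sensitiveStDivisionEasy_proof :
    Summit.ValiantsHypothesis.ValiantsHypothesis.Theses.DivisionGap.SensitiveStDivisionEasy := by
  refine ⟨60, fun N ε _ sub => ⟨val NNReal N N (Sum.inr 1), pr_ne_zero N, ?_⟩⟩
  exact complexity_witness_le N (fun t => Iff.rfl) _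

end Summit.ValiantsHypothesis.ValiantsHypothesis.Theorems
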